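import Literature.AlgebraicGeometry.HodgeTheory.VHSDataHodgeClassesAlongPathsTensorConstructions
import Literature.AlgebraicGeometry.HodgeTheory.VHSDataSubHodgeStructureTranslateLocusExteriorPower
import Literature.AlgebraicGeometry.HodgeTheory.VHSDataChartsIso
import Literature.AlgebraicGeometry.Motives.HodgeStructureStrictProofs
import Literature.AlgebraicGeometry.Motives.HodgeStructureQuotient
import HarnessLib

/-!
# Hodge classes along SUB-VARIATIONS: a morphism of VHS data injective on the lattices REFLECTS Hodge classes (strictness), hence reflects generic
# classes; the exceptional Hodge locus of a sub-variation lies in that of the ambient variation, and Hodge-generic points of the ambient variation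
# carry only generic Hodge classes of the sub-variation

Topic `Literature/AlgebraicGeometry/HodgeTheory` (namespace `Literature.AlgebraicGeometry.Motives.VHSData`, one lemma in `Motives.HodgeStructure.Hom`), lane
`lit-hodgefound` (seat `p08`, row g61-#17); generalises the retract case of `VHSDataHodgeGenericPointsRetracts` (`π ∘ ι = id`) to ARBITRARY morphisms injective
on lattices, the price being STRICTNESS of morphisms of Hodge structures (`Motives/HodgeStructureStrictProofs`: `HodgeStructure.Hom.strict_holds`, Deligne
Hodge II 2.3.5).  Built on `VHSDataHodgeClassesAlongPathsDescent` (`Hom.isHodgeAlong_app`), `VHSDataHodgeLocusRankJump` (`genericHodgeClasses`),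
`VHSDataHodgeClassesAlongPathsTensorConstructions` (`hodgeGenericLocus ⊆ (exceptionalHodgeLocus D p)ᶜ`), `VHSDataChartsIso` (`Hom.appRat_transport`) and
`VHSDataSubHodgeStructureTranslateLocusExteriorPower` (`exists_int_smul_eq_toRat`: rational vectors have integral multiples).  THEOREMS ONLY — no definition,
no named fact, no instance (D-0026 net debt `0`).

PRINTED SOURCES.  P. Deligne, *Théorie de Hodge II*, Thm. 2.3.5 (morphisms of Hodge structures are strict: `f(F^p) = F^p ∩ im f`; so a sub-Hodge structure
carries the INDUCED filtration and an injective morphism reflects the Hodge filtration); C. Voisin, *Hodge Theory I*, §7.3.1 (morphisms of Hodge structures,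
sub-structures), *Hodge Theory II*, §5.3.1 (Hodge loci are functorial), §5.3.3; W. Schmid (1973), §2 (`H_ℚ = H_ℤ ⊗ ℚ`); P. Deligne, LNM 163 (1970), I.1.

CONTENT.
* §1 **`HodgeStructure.Hom.mem_hodgeClasses_iff_of_injective`** (AN INJECTIVE MORPHISM OF HODGE STRUCTURES REFLECTS HODGE CLASSES: `f v ∈ Hdg^p ⟺ v ∈ Hdg^p`
  — strictness, with `Hom.baseChange_injective` of `Motives/HodgeStructureQuotient`).
* §2 `injective_homRat_of_injective` (`f : V₁,ℤ,s → V₂,ℤ,s` injective ⟹ `f_ℚ` injective: integral multiples), `Hom.injective_appRat`,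
  `Hom.injective_app_of_injective_app` (injectivity propagates along paths), **`Hom.isHodgeAt_app_iff_of_injective`** (`φ u` of type `(p,p)` at `s` ⟺ `u` is), `Hom.mem_hodgeClasses_appRat_iff_of_injective`.
* §3 **`Hom.isHodgeAlong_app_iff_of_forall_injective`** (`φ u` generic ⟺ `u` generic), **`Hom.comap_appRat_genericHodgeClasses`**
  (`φ_ℚ⁻¹(genericHodgeClasses D' p s) = genericHodgeClasses D p s`), **`exceptionalHodgeLocus_subset_of_forall_injective`** (THE EXCEPTIONAL LOCUS OF A
  SUB-VARIATION LIES IN THAT OF THE AMBIENT VARIATION), path-connected base: injective at ONE point suffices.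
* §4 **`hodgeGenericLocus_subset_compl_exceptionalHodgeLocus_of_forall_injective`**, `isHodgeAlong_univ_app_of_mem_hodgeGenericLocus` ∕
  **`isHodgeAlong_univ_of_mem_hodgeGenericLocus_of_forall_injective`** (AT A HODGE-GENERIC POINT OF THE AMBIENT VARIATION EVERY HODGE CLASS OF THE
  SUB-VARIATION OF LEVEL `p`, `2p = k`, IS GENERIC).

HONEST SCOPE.  Only the variation itself (level `p`, `2p = k`) is compared with `hodgeGenericLocus` of the ambient datum: the tensor constructions `T^{a,b}` of an
injection are not injections on the dual factors, so no inclusion of Hodge-generic loci is claimed (for retracts see `VHSDataHodgeGenericPointsRetracts`).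

## References

* [DeligneHodgeII1971] P. Deligne, *Théorie de Hodge II*, Publ. Math. IHÉS 40 (1971), Thm. 2.3.5, 2.1.
* [VoisinHodgeI2002] C. Voisin, *Hodge Theory and Complex Algebraic Geometry I*, CUP (2002), §7.3.1.
* [VoisinHodgeII2003] C. Voisin, *Hodge Theory and Complex Algebraic Geometry II*, CUP (2003), §5.3.1, §5.3.3.
* [Schmid1973] W. Schmid, *Variation of Hodge structure: the singularities of the period mapping*, Invent. Math. 22 (1973), §2.
* [Deligne1970] P. Deligne, *Équations différentielles à points singuliers réguliers*, LNM 163 (1970), I.1.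
* [GreenGriffithsKerr2012] M. Green, P. Griffiths, M. Kerr, *Mumford–Tate Groups and Domains*, Ann. of Math. Studies 183 (2012), Ch. III, (III.2).
-/

noncomputable section

open _root_.Topology _root_.Filter Set
open scoped TensorProduct

namespace Literature.AlgebraicGeometry

open Motives Motives.HodgeStructure HodgeTheory Topology

universe u v

/-! ## §1 Injective morphisms of Hodge structures reflect Hodge classes -/

namespace Motives.HodgeStructure.Hom

variable {V : Type u} [AddCommGroup V] [Module ℚ V] {W : Type v} [AddCommGroup W] [Module ℚ W] {n : ℤ}
  {H₁ : HodgeStructure V n} {H₂ : HodgeStructure W n}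

/-- **AN INJECTIVE MORPHISM OF HODGE STRUCTURES REFLECTS HODGE CLASSES**: `f v ∈ Hdg^p(H₂) ⟺ v ∈ Hdg^p(H₁)` — by STRICTNESS `f_ℂ(F^p H₁) = F^p H₂ ∩ im f_ℂ`
(a sub-Hodge structure carries the induced filtration). [cite: DeligneHodgeII1971, Thm. 2.3.5] [cite: VoisinHodgeI2002, §7.3.1] -/
theorem mem_hodgeClasses_iff_of_injective (f : Hom H₁ H₂) (hf : Function.Injective f.toLinearMap) (p : ℤ) (v : V) :
    f.toLinearMap v ∈ H₂.hodgeClasses p ↔ v ∈ H₁.hodgeClasses p := by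
  refine ⟨fun hv => ?_, fun hv => f.apply_mem_hodgeClasses hv⟩
  rw [mem_hodgeClasses_iff] at hv ⊢
  have hfx : f.toLinearMap.baseChange ℂ (ofRat v) = ofRat (f.toLinearMap v) := by
    rw [ofRat_apply, LinearMap.baseChange_tmul, ofRat_apply]
  have hmem : ofRat (f.toLinearMap v) ∈ (H₁.F p).map (f.toLinearMap.baseChange ℂ) := by
    rw [strict_holds f p]
    exact ⟨hv, ofRat v, hfx⟩
  obtain ⟨y, hy, hyx⟩ := hmem
  rw [← hfx] at hyx
  rwa [← f.baseChange_injective hf hyx]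

end Motives.HodgeStructure.Hom

namespace Motives.VHSData

variable {S : Type} [TopologicalSpace S] {k : ℤ} {D D' : VHSData S k}

/-! ## §2 Morphisms injective on lattices reflect classes of type `(p,p)` -/

/-- **`f : V₁,ℤ,s → V₂,ℤ,s` injective ⟹ `f_ℚ` injective** (every rational vector has a nonzero integral multiple which is integral, and `toRat` is
injective). [cite: Schmid1973, §2] -/
theorem injective_homRat_of_injective {s : S} {f : D.VZ.fiber s →ₗ[ℤ] D'.VZ.fiber s} (hf : Function.Injective f) :
    Function.Injective (D.homRat D' s f) := by
  rw [injective_iff_map_eq_zero]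
  intro x hx
  obtain ⟨N, hN, m, hm⟩ := D.exists_int_smul_eq_toRat s x
  have h1 : D'.toRat s (f m) = D'.toRat s 0 := by
    rw [← homRat_toRat, ← hm, map_smul, hx, smul_zero, map_zero]
  have h2 : m = 0 := hf (by rw [map_zero]; exact D'.toRat_injective_holds s h1)
  rw [h2, map_zero] at hm
  exact (smul_eq_zero.1 hm).resolve_left (Int.cast_ne_zero.2 hN)

/-- `φ_s` injective ⟹ `(φ_s)_ℚ` injective. [cite: Schmid1973, §2] -/
theorem Hom.injective_appRat (φ : Hom D D') {s : S} (h : Function.Injective (φ.app s)) : Function.Injective (φ.appRat s) :=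
  injective_homRat_of_injective h

/-- Injectivity of the lattice maps of a morphism propagates along paths (`φ_t = γ_* φ_s γ⁻¹_*`). [cite: Deligne1970, I.1] -/
theorem Hom.injective_app_of_injective_app (φ : Hom D D') {s t : S} (γ : Path.Homotopic.Quotient s t) (h : Function.Injective (φ.app s)) :
    Function.Injective (φ.app t) := by
  rw [← φ.transport_comp_app_comp_transport_symm γ, LinearMap.coe_comp, LinearMap.coe_comp]
  have h₂ : Function.Injective (D'.VZ.transport γ) := by
    rw [← LocalSystem.coe_transportEquiv]
    exact (D'.VZ.transportEquiv γ).injective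
  have h₁ : Function.Injective (D.VZ.transport γ.symm) := by
    rw [← LocalSystem.coe_transportEquiv]
    exact (D.VZ.transportEquiv γ.symm).injective
  exact h₂.comp (h.comp h₁)

/-- **A MORPHISM INJECTIVE ON THE LATTICE AT `s` REFLECTS CLASSES OF TYPE `(p,p)` AT `s`**: `φ_s u` is of type `(p,p)` iff `u` is (strictness).
[cite: DeligneHodgeII1971, Thm. 2.3.5] [cite: VoisinHodgeII2003, §5.3.1] -/
theorem Hom.isHodgeAt_app_iff_of_injective (φ : Hom D D') {s : S} (h : Function.Injective (φ.app s)) (p : ℤ) (u : D.VZ.fiber s) :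
    D'.IsHodgeAt s p (φ.app s u) ↔ D.IsHodgeAt s p u := by
  have key := (φ.hodgeHom s).mem_hodgeClasses_iff_of_injective (φ.injective_appRat h) p (D.toRat s u)
  rw [hodgeHom_toLinearMap, appRat_toRat] at key
  exact key

/-- Rational form: `(φ_s)_ℚ x ∈ Hdg^p(V'_s) ⟺ x ∈ Hdg^p(V_s)`. [cite: DeligneHodgeII1971, Thm. 2.3.5] -/
theorem Hom.mem_hodgeClasses_appRat_iff_of_injective (φ : Hom D D') {s : S} (h : Function.Injective (φ.app s)) (p : ℤ) (x : D.V.fiber s) :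
    φ.appRat s x ∈ (D'.hodge s).hodgeClasses p ↔ x ∈ (D.hodge s).hodgeClasses p :=
  (φ.hodgeHom s).mem_hodgeClasses_iff_of_injective (φ.injective_appRat h) p x

/-! ## §3 Generic classes and exceptional loci of sub-variations -/

/-- **A MORPHISM INJECTIVE ON ALL LATTICES REFLECTS GENERIC CLASSES**: `φ_s u` remains of type `(p,p)` along `W` iff `u` does.
[cite: VoisinHodgeII2003, §5.3.1] [cite: DeligneHodgeII1971, Thm. 2.3.5] -/
theorem Hom.isHodgeAlong_app_iff_of_forall_injective (φ : Hom D D') (h : ∀ t : S, Function.Injective (φ.app t)) {p : ℤ} {s : S} (u : D.VZ.fiber s)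
    (W : Set S) : D'.IsHodgeAlong p (φ.app s u) W ↔ D.IsHodgeAlong p u W := by
  refine ⟨fun hu t γ hγ => (φ.isHodgeAt_app_iff_of_injective (h t) p _).1 ?_, fun hu => φ.isHodgeAlong_app hu⟩
  rw [φ.app_transport]
  exact hu γ hγ

/-- **`φ_ℚ⁻¹ (genericHodgeClasses D' p s) = genericHodgeClasses D p s`** for a morphism injective on all lattices. [cite: VoisinHodgeII2003, §5.3.1 Def. 5.12]
[cite: DeligneHodgeII1971, Thm. 2.3.5] -/
theorem Hom.comap_appRat_genericHodgeClasses (φ : Hom D D') (h : ∀ t : S, Function.Injective (φ.app t)) (p : ℤ) (s : S) :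
    (D'.genericHodgeClasses p s).comap (φ.appRat s) = D.genericHodgeClasses p s := by
  ext x
  rw [Submodule.mem_comap, mem_genericHodgeClasses_iff, mem_genericHodgeClasses_iff]
  refine forall_congr' fun t => forall_congr' fun γ => ?_
  rw [← φ.appRat_transport, φ.mem_hodgeClasses_appRat_iff_of_injective (h t)]

/-- **THE EXCEPTIONAL HODGE LOCUS OF A SUB-VARIATION LIES IN THAT OF THE AMBIENT VARIATION** (`φ : D → D'` injective on all lattices).
[cite: VoisinHodgeII2003, §5.3.1 and §5.3.3] [cite: DeligneHodgeII1971, Thm. 2.3.5] -/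
theorem exceptionalHodgeLocus_subset_of_forall_injective (φ : Hom D D') (h : ∀ t : S, Function.Injective (φ.app t)) (p : ℤ) :
    D.exceptionalHodgeLocus p ⊆ D'.exceptionalHodgeLocus p := by
  rintro s ⟨u, hu, hnot⟩
  exact ⟨φ.app s u, φ.isHodgeAt_app hu, fun hgen => hnot ((φ.isHodgeAlong_app_iff_of_forall_injective h u univ).1 hgen)⟩

/-- Path-connected base: injectivity at ONE point suffices. [cite: VoisinHodgeII2003, §5.3.1] [cite: Deligne1970, I.1] -/
theorem exceptionalHodgeLocus_subset_of_injective_app [PathConnectedSpace S] (φ : Hom D D') {s₀ : S} (h : Function.Injective (φ.app s₀)) (p : ℤ) :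
    D.exceptionalHodgeLocus p ⊆ D'.exceptionalHodgeLocus p :=
  exceptionalHodgeLocus_subset_of_forall_injective φ
    (fun t => φ.injective_app_of_injective_app (Path.Homotopic.Quotient.mk (PathConnectedSpace.somePath s₀ t)) h) p

/-! ## §4 Sub-variations at Hodge-generic points of the ambient variation -/

/-- **Hodge-generic points of the ambient variation are outside the exceptional locus of every sub-variation** (level `p`, `2p = k`).
[cite: VoisinHodgeII2003, §5.3.3] [cite: GreenGriffithsKerr2012, Ch. III (III.2)] -/
theorem hodgeGenericLocus_subset_compl_exceptionalHodgeLocus_of_forall_injective (φ : Hom D D') (h : ∀ t : S, Function.Injective (φ.app t)) {p : ℤ}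
    (hp : p + p = k) : D'.hodgeGenericLocus ⊆ (D.exceptionalHodgeLocus p)ᶜ :=
  fun _ hs hmem => hodgeGenericLocus_subset_compl_exceptionalHodgeLocus_self hp hs (exceptionalHodgeLocus_subset_of_forall_injective φ h p hmem)

/-- **AT A HODGE-GENERIC POINT OF THE AMBIENT VARIATION EVERY HODGE CLASS OF A SUB-VARIATION (level `p`, `2p = k`) IS GENERIC.**
[cite: VoisinHodgeII2003, §5.3.3] [cite: GreenGriffithsKerr2012, Ch. III (III.2)] [cite: DeligneHodgeII1971, Thm. 2.3.5] -/
theorem isHodgeAlong_univ_of_mem_hodgeGenericLocus_of_forall_injective (φ : Hom D D') (h : ∀ t : S, Function.Injective (φ.app t)) {s : S}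
    (hs : s ∈ D'.hodgeGenericLocus) {p : ℤ} (hp : p + p = k) {u : D.VZ.fiber s} (hu : D.IsHodgeAt s p u) : D.IsHodgeAlong p u univ := by
  by_contra hnot
  exact hodgeGenericLocus_subset_compl_exceptionalHodgeLocus_of_forall_injective φ h hp hs ⟨u, hu, hnot⟩

/-- Without injectivity, one direction survives: at a Hodge-generic point of `D'` the IMAGE `φ_s u` of every class of type `(p,p)` of `D` is generic for `D'`.
[cite: VoisinHodgeII2003, §5.3.1 and §5.3.3] -/
theorem isHodgeAlong_univ_app_of_mem_hodgeGenericLocus (φ : Hom D D') {s : S} (hs : s ∈ D'.hodgeGenericLocus) {p : ℤ} (hp : p + p = k)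
    {u : D.VZ.fiber s} (hu : D.IsHodgeAt s p u) : D'.IsHodgeAlong p (φ.app s u) univ :=
  isHodgeAlong_univ_of_mem_hodgeGenericLocus_self hs hp (φ.isHodgeAt_app hu)

end Motives.VHSData

end Literature.AlgebraicGeometry

end
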